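import Summits.Ventures.LatticeQCDFlow.TrivializingMaps.FisherZeroRadiusSharp

/-!
HONEST FRAMING: exact (Metropolis-corrected) sampling algorithms for lattice gauge theory; figures
of merit are autocorrelation/cost numbers at stated couplings and volumes; no continuum-physics
claim.

# FisherZeroRadiusSharpWitness — the constant in "a zero within `4·(half-range)/variance`" cannot be
# taken below `π/2` (lean-2 GEN-7, ours)

Venture-side (OURS).  Cell `lqcd-flow` (pub-lqcd), unit `pub-lqcd-lean-2-g7`, 2026-08-22.

`FisherZeroRadiusSharp.exists_zero_norm_le_of_variance_pos`: `|X − c| ≤ b` a.e., `Var X > 0` `⇒` the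
complex MGF `z ↦ ∫ e^{zX} dμ` has a zero with `|z| ≤ 4|b|/Var X`.  How much room is left in the
constant `4`?  The fair sign `X = ±1` (probability `½` each; `b = 1`, `c = 0`, `Var X = 1`) has
`∫ e^{zX} = cosh z`, whose zeros are `iπ(k + ½)`, the nearest at distance `π/2 = 1.5707…`.  Hence:

* `FairSign.fairSign_complexMGF` — the MGF of the fair sign is `cosh`; `FairSign.fairSign_variance` —
  its variance is `1`; `FairSign.cosh_ne_zero_of_norm_lt` — `cosh` has no zero in `|z| < π/2`;
* **`radiusLaw_four`** — the law "a zero within `C·|b|/Var X`" HOLDS with `C = 4` (our theorem), and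
  **`pi_div_two_le_of_radiusLaw`** — every constant `C` for which it holds (for all probability spaces,
  all bounded non-degenerate `X`) satisfies `π/2 ≤ C`.

So the sharp constant lies in `[π/2, 4]`; for the `SU(2)` Wilson action (radius `8 = 4·2/1`) no
argument using only the range and the β = 0 variance of the action can place a Fisher zero inside
`|s| < π` — value-free calibration of T17.  NOT CLAIMED: the value of the sharp constant; anything
about where the Wilson zeros actually are.
-/

open MeasureTheory ProbabilityTheory Complex Set Metric
open scoped ENNReal

namespace Summit.Ventures.LatticeQCDFlow.TrivializingMaps

namespace FairSign

/-- The fair-sign law on `Bool`: mass `½` on each point. -/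
theorem isProbabilityMeasure_half_count :
    IsProbabilityMeasure ((2⁻¹ : ℝ≥0∞) • (Measure.count : Measure Bool)) := by
  refine ⟨?_⟩
  rw [Measure.smul_apply, Measure.count_univ, smul_eq_mul]
  simp only [ENat.card_eq_coe_fintype_card, Fintype.card_bool, Nat.cast_ofNat]
  norm_num [ENNReal.inv_mul_cancel]

/-- Integrals against the fair-sign law are two-point averages. -/
theorem integral_half_count (f : Bool → ℝ) :
    ∫ b, f b ∂((2⁻¹ : ℝ≥0∞) • (Measure.count : Measure Bool)) = 2⁻¹ * f true + 2⁻¹ * f false := by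
  rw [integral_smul_measure, integral_fintype Integrable.of_finite]
  simp [Measure.real, ENNReal.toReal_inv]
  ring

/-- Complex-valued version. -/
theorem integral_half_count_complex (f : Bool → ℂ) :
    ∫ b, f b ∂((2⁻¹ : ℝ≥0∞) • (Measure.count : Measure Bool)) =
      (2⁻¹ : ℂ) * f true + (2⁻¹ : ℂ) * f false := by
  rw [integral_smul_measure, integral_fintype Integrable.of_finite]
  simp [Measure.real, ENNReal.toReal_inv, Complex.real_smul]

/-- **The MGF of the fair sign is `cosh`.** -/
theorem fairSign_complexMGF (z : ℂ) :
    complexMGF (fun b : Bool => if b then (1 : ℝ) else -1)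
      ((2⁻¹ : ℝ≥0∞) • (Measure.count : Measure Bool)) z = Complex.cosh z := by
  unfold complexMGF
  rw [integral_half_count_complex, Complex.cosh]
  simp only [if_true, Bool.false_eq_true, if_false, Complex.ofReal_one, Complex.ofReal_neg, mul_one,
    mul_neg]
  ring

/-- **The variance of the fair sign is `1`.** -/
theorem fairSign_variance :
    variance (fun b : Bool => if b then (1 : ℝ) else -1)
      ((2⁻¹ : ℝ≥0∞) • (Measure.count : Measure Bool)) = 1 := by
  haveI := isProbabilityMeasure_half_count
  have hmem : MemLp (fun b : Bool => if b then (1 : ℝ) else -1) 2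
      ((2⁻¹ : ℝ≥0∞) • (Measure.count : Measure Bool)) :=
    MemLp.of_bound (Measurable.of_discrete.aestronglyMeasurable) 1
      (ae_of_all _ fun b => by split_ifs <;> simp)
  rw [variance_eq_sub hmem, integral_half_count, integral_half_count]
  simp only [Pi.pow_apply, if_true, Bool.false_eq_true, if_false]
  norm_num

/-- **`cosh` has no zero in the open disc `|z| < π/2`** (its zeros are `iπ(k + ½)`). -/
theorem cosh_ne_zero_of_norm_lt {z : ℂ} (hz : ‖z‖ < Real.pi / 2) : Complex.cosh z ≠ 0 := by
  intro h0
  have hcos : Complex.cos (z * I) = 0 := by rw [Complex.cos_mul_I]; exact h0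
  obtain ⟨k, hk⟩ := Complex.cos_eq_zero_iff.mp hcos
  have hnorm : ‖z‖ = |(2 * (k : ℝ) + 1)| * Real.pi / 2 := by
    have h1 : ‖z * I‖ = ‖z‖ := by rw [norm_mul, Complex.norm_I, mul_one]
    rw [← h1, hk]
    rw [show (2 * (k : ℂ) + 1) * Real.pi / 2 = (((2 * (k : ℝ) + 1) * Real.pi / 2 : ℝ) : ℂ) by
      push_cast; ring]
    rw [Complex.norm_real, Real.norm_eq_abs, abs_div, abs_mul, abs_of_pos Real.pi_pos,
      abs_of_pos (by norm_num : (0 : ℝ) < 2)]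
  have hk1 : (1 : ℝ) ≤ |2 * (k : ℝ) + 1| := by
    rcases le_or_gt 0 k with hk0 | hk0
    · rw [abs_of_nonneg (by positivity)]
      have : (0 : ℝ) ≤ k := by exact_mod_cast hk0
      linarith
    · have : (k : ℝ) ≤ -1 := by exact_mod_cast (Int.le_sub_one_of_lt hk0)
      rw [abs_of_neg (by linarith)]
      linarith
  have : Real.pi / 2 ≤ ‖z‖ := by
    rw [hnorm]
    have := Real.pi_pos
    nlinarith
  linarith

/-- The fair sign's MGF is zero-free on `|z| < π/2`. -/
theorem fairSign_complexMGF_ne_zero {z : ℂ} (hz : ‖z‖ < Real.pi / 2) :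
    complexMGF (fun b : Bool => if b then (1 : ℝ) else -1)
      ((2⁻¹ : ℝ≥0∞) • (Measure.count : Measure Bool)) z ≠ 0 := by
  rw [fairSign_complexMGF]
  exact cosh_ne_zero_of_norm_lt hz

end FairSign

/-! ## The law with constant `C`, and its calibration `π/2 ≤ C ≤ 4` -/

/-- **The radius law holds with constant `4`** (= `exists_zero_norm_le_of_variance_pos`): on every
probability space, every a.e.-bounded `|X − c| ≤ b` with `Var X > 0` has an MGF zero with
`|z| ≤ 4|b|/Var X`. [ours] -/
theorem radiusLaw_four {Ω : Type*} [MeasurableSpace Ω] (μ : Measure Ω) [IsProbabilityMeasure μ]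
    (X : Ω → ℝ) (b c : ℝ) (hm : AEMeasurable X μ) (hb : ∀ᵐ u ∂μ, |X u - c| ≤ b)
    (hvar : 0 < variance X μ) :
    ∃ z : ℂ, ‖z‖ ≤ 4 * |b| / variance X μ ∧ complexMGF X μ z = 0 :=
  exists_zero_norm_le_of_variance_pos hm hb hvar

/-- **No constant below `π/2`.**  If for every probability space and every a.e.-bounded
`|X − c| ≤ b` with `Var X > 0` the MGF has a zero with `|z| ≤ C|b|/Var X`, then `π/2 ≤ C`
(the fair sign: `b = 1`, `Var = 1`, zero-free on `|z| < π/2`). [ours] -/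
theorem pi_div_two_le_of_radiusLaw {C : ℝ}
    (hC : ∀ (Ω : Type) [MeasurableSpace Ω] (μ : Measure Ω) [IsProbabilityMeasure μ] (X : Ω → ℝ)
      (b c : ℝ), AEMeasurable X μ → (∀ᵐ u ∂μ, |X u - c| ≤ b) → 0 < variance X μ →
      ∃ z : ℂ, ‖z‖ ≤ C * |b| / variance X μ ∧ complexMGF X μ z = 0) :
    Real.pi / 2 ≤ C := by
  haveI := FairSign.isProbabilityMeasure_half_count
  obtain ⟨z, hz, hz0⟩ := hC Bool ((2⁻¹ : ℝ≥0∞) • (Measure.count : Measure Bool))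
    (fun b : Bool => if b then (1 : ℝ) else -1) 1 0 Measurable.of_discrete.aemeasurable
    (ae_of_all _ fun b => by split_ifs <;> simp) (by rw [FairSign.fairSign_variance]; norm_num)
  rw [FairSign.fairSign_variance, abs_one, mul_one, div_one] at hz
  by_contra hlt
  push Not at hlt
  exact FairSign.fairSign_complexMGF_ne_zero (lt_of_le_of_lt hz hlt) hz0

end Summit.Ventures.LatticeQCDFlow.TrivializingMaps
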